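import Summits.CriticalPhenomena.PercolationContinuityZ3.Theorems.PercNearOneGluingNoHeavyLowerTailGeneralTerminalSeparation
import Literature.Probability.LatticeModels.ProdBernoulliClusterLocality
import HarnessLib

/-!
# `NoHeavyLowerTail` (stmt-CriticalPhenomena-4575), one-cut line — BLOCK terminal separation (a relay SET in place of
# the vertex), by gluing

For a finite weighted graph on `Fin n` (`μ = prodBernoulli w`), a vertex `o`, vertex sets `B` (the block) and `T`,
and a finite set `P` of pairs starting in `T` (`Q = {t ↮ u ∀ (t,u) ∈ P}`):

  `μ({o ↔ B} ∩ {B ↮ T}) · μ({B ↮ T} ∩ Q) ≤ μ({B ↮ T}) · μ({o ↔ B} ∩ ({B ↮ T} ∩ Q))`   (`blockTerminalSeparation`)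

where `{o ↔ B} = {∃ b ∈ B, o ↔ b}` and `{B ↮ T} = {∀ b ∈ B, ∀ t ∈ T, b ↮ t}`.  This is Kozma–Nitzan's Lemma 1(i)
(arXiv:2401.12397 p. 5) for a block `A(X) = B` — the ingredient of their Lemma 2 with NON-singleton blocks.  Proof
(the standard gluing remark): the four events see `B` only through open paths that can be stopped at their first
vertex in `B`, hence are DETERMINED BY the edges not internal to `B` (`determinedBy_glue`); so their probabilities do
not change when the weights of the `B`-internal edges are raised to `1` (`prodBernoulli_real_eq_of_determinedBy`);
under the glued weights `B` is a.s. a clique of open edges, on which `{o ↔ B} = {o ↔ b₀}` and `{B ↮ T} = {b₀ ↮ T}`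
for any `b₀ ∈ B`, and the vertex statement is `terminalSeparation_general`.
-/

namespace Summit.CriticalPhenomena.PercolationContinuityZ3.Theorems

open scoped BigOperators Classical
open MeasureTheory Set
open Literature.Probability.LatticeModels (prodBernoulli prodBernoulli_real_eq_of_determinedBy
  prodBernoulli_real_setOf_mem)
open Literature.Probability.Percolation

variable {n : ℕ}

namespace BlockSeparation

/-! ### Walks and the edges internal to `B` -/

/-- First entrance: a walk from `u` to a vertex of `B` has an initial segment ending at some `b ∈ B`
whose support meets `B` only in `{u, b}`. [folklore] -/
theorem exists_walk_firstMem {V : Type*} {G : SimpleGraph V} (B : Set V) {u v : V}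
    (p : G.Walk u v) (hv : v ∈ B) :
    ∃ b ∈ B, ∃ q : G.Walk u b, ∀ x ∈ q.support, x ∈ B → x = u ∨ x = b := by
  induction p with
  | @nil u => exact ⟨u, hv, SimpleGraph.Walk.nil, fun x hx _ => Or.inl (by simpa using hx)⟩
  | @cons u u₁ v h p ih =>
    by_cases hu : u ∈ B
    · exact ⟨u, hu, SimpleGraph.Walk.nil, fun x hx _ => Or.inl (by simpa using hx)⟩
    obtain ⟨b, hb, q, hq⟩ := ih hv
    by_cases hu₁ : u₁ ∈ B
    · refine ⟨u₁, hu₁, SimpleGraph.Walk.cons h SimpleGraph.Walk.nil, fun x hx _ => ?_⟩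
      simpa using hx
    · refine ⟨b, hb, SimpleGraph.Walk.cons h q, fun x hx hxB => ?_⟩
      rw [SimpleGraph.Walk.support_cons, List.mem_cons] at hx
      rcases hx with rfl | hx
      · exact Or.inl rfl
      · rcases hq x hx hxB with rfl | rfl
        · exact absurd hxB hu₁
        · exact Or.inr rfl

/-- A walk none of whose edges is internal to `B` (both endpoints in `B`) is a walk of the open graph of
`ω ∩ {edges not internal to B}`. [folklore] -/
theorem reachable_inter_notInternal {ω : BondConfig (Fin n)} {B : Finset (Fin n)} {u v : Fin n}
    (p : (openGraph ω).Walk u v) (hp : ∀ e ∈ p.edges, ¬ (∀ x ∈ e, x ∈ B)) :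
    (openGraph (ω ∩ {e | ¬ ∀ x ∈ e, x ∈ B})).Reachable u v := by
  refine ⟨p.transfer (openGraph (ω ∩ {e | ¬ ∀ x ∈ e, x ∈ B})) fun e he => ?_⟩
  have h1 : e ∈ (openGraph ω).edgeSet := p.edges_subset_edgeSet he
  simp only [openGraph, SimpleGraph.edgeSet_fromEdgeSet, mem_sdiff, mem_setOf_eq, mem_inter_iff]
    at h1 ⊢
  exact ⟨⟨h1.1, hp e he⟩, h1.2⟩

/-- If `u ∉ B` reaches a vertex of `B` in `ω`, then `u` reaches some vertex of `B` using no edge internal to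
`B` (stop at the first vertex in `B`). [folklore] -/
theorem reaches_block_notInternal {ω : BondConfig (Fin n)} {B : Finset (Fin n)} {u v : Fin n}
    (hu : u ∉ B) (hv : v ∈ B) (h : (openGraph ω).Reachable u v) :
    ∃ b ∈ B, (openGraph (ω ∩ {e | ¬ ∀ x ∈ e, x ∈ B})).Reachable u b := by
  obtain ⟨p⟩ := h
  obtain ⟨b, hb, q, hq⟩ := exists_walk_firstMem (↑B : Set (Fin n)) p (Finset.mem_coe.2 hv)
  refine ⟨b, Finset.mem_coe.1 hb, reachable_inter_notInternal q ?_⟩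
  intro e he hint
  revert he hint
  refine Sym2.ind (fun x y => ?_) e
  intro he hint
  have hadj : (openGraph ω).Adj x y := by
    have := q.edges_subset_edgeSet he
    rwa [SimpleGraph.mem_edgeSet] at this
  have hx : x ∈ q.support := SimpleGraph.Walk.fst_mem_support_of_mem_edges q he
  have hy : y ∈ q.support := SimpleGraph.Walk.snd_mem_support_of_mem_edges q he
  have hxB : x ∈ B := hint x (Sym2.mem_mk_left x y)
  have hyB : y ∈ B := hint y (Sym2.mem_mk_right x y)
  have hx' : x = b := by
    rcases hq x hx (Finset.mem_coe.2 hxB) with rfl | rfl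
    · exact absurd hxB hu
    · rfl
  have hy' : y = b := by
    rcases hq y hy (Finset.mem_coe.2 hyB) with rfl | rfl
    · exact absurd hyB hu
    · rfl
  exact hadj.ne (hx'.trans hy'.symm)

/-- Monotonicity: reachability in the open graph of a smaller configuration persists. [folklore] -/
theorem reachable_mono {ω ω' : BondConfig (Fin n)} (h : ω ⊆ ω') {u v : Fin n}
    (hr : (openGraph ω).Reachable u v) : (openGraph ω').Reachable u v :=
  hr.mono (SimpleGraph.fromEdgeSet_mono h)

/-- **Transfer across configurations that agree off the `B`-internal edges.**  If `ω ∩ F = ω' ∩ F` with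
`F = {edges not internal to B}`, `B ∩ T = ∅`, and `B ↮ T` in `ω`, then every vertex `t ∈ T` reaches in `ω'`
only vertices it reaches in `ω`. [folklore] -/
theorem reach_transfer {ω ω' : BondConfig (Fin n)} {B T : Finset (Fin n)}
    (hF : ω ∩ {e | ¬ ∀ x ∈ e, x ∈ B} = ω' ∩ {e | ¬ ∀ x ∈ e, x ∈ B})
    (hBT : ∀ b ∈ B, b ∉ T) (hsep : ∀ b ∈ B, ∀ t ∈ T, ω ∉ openConn b t)
    {t u : Fin n} (ht : t ∈ T) (h : (openGraph ω').Reachable t u) : (openGraph ω).Reachable t u := by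
  obtain ⟨p⟩ := h
  by_cases hp : ∀ e ∈ p.edges, ¬ (∀ x ∈ e, x ∈ B)
  · have h1 := reachable_inter_notInternal p hp
    rw [← hF] at h1
    exact reachable_mono inter_subset_left h1
  · -- `p` uses an internal edge of `B`, so `t` reaches `B` in `ω'`, hence in `ω` off the internal edges
    push Not at hp
    obtain ⟨e, he, hint⟩ := hp
    revert he hint
    refine Sym2.ind (fun x y => ?_) e
    intro he hint
    have hx : x ∈ p.support := SimpleGraph.Walk.fst_mem_support_of_mem_edges p he
    have hxB : x ∈ B := hint x (Sym2.mem_mk_left x y)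
    have htB : t ∉ B := fun htB => hBT t htB ht
    have htx : (openGraph ω').Reachable t x := ⟨p.takeUntil x hx⟩
    obtain ⟨b, hb, hreach⟩ := reaches_block_notInternal htB hxB htx
    rw [← hF] at hreach
    have : (openGraph ω).Reachable b t := (reachable_mono inter_subset_left hreach).symm
    exact absurd this (hsep b hb t ht)

/-- One direction of the determination: if `ω, ω'` agree off the `B`-internal edges and `ω` lies in
`{o ↔ B} ∩ {B ↮ T} ∩ Q` (with `o ∉ B`, `B ∩ T = ∅`, pairs of `P` starting in `T`), so does `ω'`; the same
for the events without `{o ↔ B}` and/or without `Q` (take `O`/`P` empty). [folklore] -/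
theorem transfer_events {ω ω' : BondConfig (Fin n)} {B T : Finset (Fin n)} {o : Fin n}
    {P : Finset (Fin n × Fin n)}
    (hF : ω ∩ {e | ¬ ∀ x ∈ e, x ∈ B} = ω' ∩ {e | ¬ ∀ x ∈ e, x ∈ B})
    (hoB : o ∉ B) (hBT : ∀ b ∈ B, b ∉ T) (hP : ∀ p ∈ P, p.1 ∈ T)
    (hsep : ∀ b ∈ B, ∀ t ∈ T, ω ∉ openConn b t) :
    (∀ b ∈ B, ∀ t ∈ T, ω' ∉ openConn b t) ∧
      ((∃ b ∈ B, ω ∈ openConn o b) → ∃ b ∈ B, ω' ∈ openConn o b) ∧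
      ((∀ p ∈ P, ω ∉ openConn p.1 p.2) → ∀ p ∈ P, ω' ∉ openConn p.1 p.2) := by
  refine ⟨fun b hb t ht hbt => ?_, fun ⟨b, hb, hob⟩ => ?_, fun hQ p hp hconn => ?_⟩
  · have h : (openGraph ω').Reachable t b := SimpleGraph.Reachable.symm hbt
    exact hsep b hb t ht (reach_transfer hF hBT hsep ht h).symm
  · obtain ⟨b', hb', hreach⟩ := reaches_block_notInternal hoB hb (show (openGraph ω).Reachable o b from hob)
    rw [hF] at hreach
    exact ⟨b', hb', reachable_mono inter_subset_left hreach⟩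
  · exact hQ p hp (reach_transfer hF hBT hsep (hP p hp) hconn)

/-- The events `{B ↮ T}`, `{o ↔ B} ∩ {B ↮ T}`, `{B ↮ T} ∩ Q`, `{o ↔ B} ∩ ({B ↮ T} ∩ Q)` are determined by
the edges not internal to `B`. [folklore] -/
theorem determinedBy_glue (B T : Finset (Fin n)) (o : Fin n) (P : Finset (Fin n × Fin n))
    (hoB : o ∉ B) (hBT : ∀ b ∈ B, b ∉ T) (hP : ∀ p ∈ P, p.1 ∈ T)
    (useO useQ : Bool) :
    DeterminedBy
      ({ω : BondConfig (Fin n) | useO = true → ∃ b ∈ B, ω ∈ openConn o b} ∩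
        ({ω | ∀ b ∈ B, ∀ t ∈ T, ω ∉ openConn b t} ∩
          {ω | useQ = true → ∀ p ∈ P, ω ∉ openConn p.1 p.2}))
      {e | ¬ ∀ x ∈ e, x ∈ B} := by
  rw [determinedBy_iff]
  intro ω ω' hF
  constructor
  · rintro ⟨hO, hsep, hQ⟩
    obtain ⟨h1, h2, h3⟩ := transfer_events hF hoB hBT hP hsep
    exact ⟨fun hu => h2 (hO hu), h1, fun hu => h3 (hQ hu)⟩
  · rintro ⟨hO, hsep, hQ⟩
    obtain ⟨h1, h2, h3⟩ := transfer_events hF.symm hoB hBT hP hsep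
    exact ⟨fun hu => h2 (hO hu), h1, fun hu => h3 (hQ hu)⟩

/-! ### Gluing: the weights of the `B`-internal edges raised to `1` -/

/-- Under weights equal to `1` on the `B`-internal edges, a.s. every pair of distinct vertices of `B` is
joined by an open edge. [folklore] -/
theorem glue_null (w' : Sym2 (Fin n) → unitInterval) (B : Finset (Fin n))
    (hw' : ∀ e : Sym2 (Fin n), (∀ x ∈ e, x ∈ B) → (w' e : ℝ) = 1) :
    (prodBernoulli w').real {ω : BondConfig (Fin n) | ∀ b ∈ B, ∀ b' ∈ B, b ≠ b' → s(b, b') ∈ ω}ᶜ = 0 := by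
  have hsub : {ω : BondConfig (Fin n) | ∀ b ∈ B, ∀ b' ∈ B, b ≠ b' → s(b, b') ∈ ω}ᶜ ⊆
      ⋃ q ∈ B ×ˢ B, {ω : BondConfig (Fin n) | s(q.1, q.2) ∉ ω} := by
    intro ω hω
    simp only [mem_compl_iff, mem_setOf_eq, not_forall] at hω
    obtain ⟨b, hb, b', hb', _, h⟩ := hω
    exact mem_iUnion₂.2 ⟨(b, b'), Finset.mem_product.2 ⟨hb, hb'⟩, h⟩
  refine le_antisymm ((measureReal_mono hsub (measure_ne_top _ _)).trans ?_) measureReal_nonneg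
  refine (measureReal_biUnion_finset_le (B ×ˢ B) _).trans (le_of_eq ?_)
  refine Finset.sum_eq_zero fun q hq => ?_
  obtain ⟨hb, hb'⟩ := Finset.mem_product.1 hq
  have h1 : (prodBernoulli w').real {ω : BondConfig (Fin n) | s(q.1, q.2) ∈ ω} = 1 := by
    rw [prodBernoulli_real_setOf_mem]
    exact hw' _ fun x hx => by
      rcases Sym2.mem_iff.1 hx with rfl | rfl
      · exact hb
      · exact hb'
  have h2 : {ω : BondConfig (Fin n) | s(q.1, q.2) ∉ ω} = {ω : BondConfig (Fin n) | s(q.1, q.2) ∈ ω}ᶜ := rfl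
  rw [h2, measureReal_compl MeasurableSet.of_discrete, h1, probReal_univ, sub_self]

/-- On the clique event, `{o ↔ B} = {o ↔ b₀}` and `{B ↮ T} = {b₀ ↮ T}` for `b₀ ∈ B`: an event of the form
`[∃ b ∈ B, o↔b] ∩ {B↮T} ∩ [Q]` meets the clique event exactly where `[b₀ ↔ o] ∩ {b₀ ↮ T} ∩ [Q]` does. [folklore] -/
theorem inter_clique_eq (B T : Finset (Fin n)) (o b₀ : Fin n) (hb₀ : b₀ ∈ B) (P : Finset (Fin n × Fin n))
    (useO useQ : Bool) :
    ({ω : BondConfig (Fin n) | useO = true → ∃ b ∈ B, ω ∈ openConn o b} ∩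
        ({ω | ∀ b ∈ B, ∀ t ∈ T, ω ∉ openConn b t} ∩
          {ω | useQ = true → ∀ p ∈ P, ω ∉ openConn p.1 p.2})) ∩
      {ω : BondConfig (Fin n) | ∀ b ∈ B, ∀ b' ∈ B, b ≠ b' → s(b, b') ∈ ω} =
    ({ω : BondConfig (Fin n) | useO = true → ∀ v ∈ ({o} : Finset (Fin n)), ω ∈ openConn b₀ v} ∩
        ({ω | ∀ t ∈ T, ω ∉ openConn b₀ t} ∩
          {ω | useQ = true → ∀ p ∈ P, ω ∉ openConn p.1 p.2})) ∩
      {ω : BondConfig (Fin n) | ∀ b ∈ B, ∀ b' ∈ B, b ≠ b' → s(b, b') ∈ ω} := by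
  ext ω
  simp only [mem_inter_iff, mem_setOf_eq, Finset.mem_singleton, forall_eq]
  constructor
  · rintro ⟨⟨hO, hsep, hQ⟩, hcl⟩
    refine ⟨⟨fun hu => ?_, fun t ht => hsep b₀ hb₀ t ht, hQ⟩, hcl⟩
    obtain ⟨b, hb, hob⟩ := hO hu
    have hob' : (openGraph ω).Reachable o b := hob
    by_cases hbb : b = b₀
    · subst hbb; exact hob'.symm
    · have hadj : (openGraph ω).Adj b b₀ := (openGraph_adj ω b b₀).2 ⟨hcl b hb b₀ hb₀ hbb, hbb⟩
      exact (hob'.trans hadj.reachable).symm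
  · rintro ⟨⟨hO, hsep, hQ⟩, hcl⟩
    refine ⟨⟨fun hu => ⟨b₀, hb₀, SimpleGraph.Reachable.symm (hO hu)⟩, fun b hb t ht hbt => ?_, hQ⟩, hcl⟩
    have hbt' : (openGraph ω).Reachable b t := hbt
    by_cases hbb : b = b₀
    · subst hbb; exact hsep t ht hbt'
    · have hadj : (openGraph ω).Adj b₀ b := (openGraph_adj ω b₀ b).2 ⟨hcl b₀ hb₀ b hb (Ne.symm hbb), Ne.symm hbb⟩
      exact hsep t ht (hadj.reachable.trans hbt')

/-- If `μ(Gᶜ) = 0` then `μ(X) = μ(X ∩ G)`. [folklore] -/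
theorem real_eq_real_inter_of_null {μ : Measure (BondConfig (Fin n))} [IsFiniteMeasure μ]
    (X G : Set (BondConfig (Fin n))) (hG : μ.real Gᶜ = 0) : μ.real X = μ.real (X ∩ G) := by
  have h := measureReal_inter_add_sdiff₀ (μ := μ) (s := X) (t := G) MeasurableSet.of_discrete.nullMeasurableSet
  have h0 : μ.real (X \ G) = 0 :=
    le_antisymm ((measureReal_mono (fun ω hω => hω.2)).trans (le_of_eq hG)) measureReal_nonneg
  rw [h0, add_zero] at h
  exact h.symm

end BlockSeparation

open BlockSeparation GeneralTerminalSeparation in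
/-- **Block terminal separation (Kozma–Nitzan Lemma 1(i) for a block), unconditional.**  For
`μ = prodBernoulli w` on `Fin n`, a vertex `o`, vertex sets `B, T` and a finite set `P` of pairs starting in
`T` (`Q = {t ↮ u ∀ (t,u) ∈ P}`):
`μ({o↔B} ∩ {B↮T}) · μ({B↮T} ∩ Q) ≤ μ({B↮T}) · μ({o↔B} ∩ ({B↮T} ∩ Q))`,
`{o↔B} = {∃ b ∈ B, o ↔ b}`, `{B↮T} = {∀ b ∈ B, ∀ t ∈ T, b ↮ t}`.
[cite: KozmaNitzan2024, Lemma 1(i) (p. 5); VandenbergHaggstromKahn2005, Thm. 1.3] -/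
theorem blockTerminalSeparation (w : Sym2 (Fin n) → unitInterval) (B T : Finset (Fin n)) (o : Fin n)
    (P : Finset (Fin n × Fin n)) (hP : ∀ p ∈ P, p.1 ∈ T) :
    (prodBernoulli w).real ({ω | ∃ b ∈ B, ω ∈ openConn o b} ∩ {ω | ∀ b ∈ B, ∀ t ∈ T, ω ∉ openConn b t}) *
        (prodBernoulli w).real ({ω | ∀ b ∈ B, ∀ t ∈ T, ω ∉ openConn b t} ∩
          {ω | ∀ p ∈ P, ω ∉ openConn p.1 p.2}) ≤
      (prodBernoulli w).real {ω | ∀ b ∈ B, ∀ t ∈ T, ω ∉ openConn b t} *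
        (prodBernoulli w).real ({ω | ∃ b ∈ B, ω ∈ openConn o b} ∩
          ({ω | ∀ b ∈ B, ∀ t ∈ T, ω ∉ openConn b t} ∩ {ω | ∀ p ∈ P, ω ∉ openConn p.1 p.2})) := by
  set μ := prodBernoulli w with hμ
  set D : Set (BondConfig (Fin n)) := {ω | ∀ b ∈ B, ∀ t ∈ T, ω ∉ openConn b t} with hD
  set E : Set (BondConfig (Fin n)) := {ω | ∃ b ∈ B, ω ∈ openConn o b} with hE
  set Q : Set (BondConfig (Fin n)) := {ω | ∀ p ∈ P, ω ∉ openConn p.1 p.2} with hQ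
  -- degenerate cases
  by_cases hBT : ∀ b ∈ B, b ∉ T
  swap
  · -- `B ∩ T ≠ ∅`: `D = ∅`
    push Not at hBT
    obtain ⟨b, hb, hbT⟩ := hBT
    have hD0 : D = ∅ := Set.subset_empty_iff.1 fun ω hω => hω b hb b hbT (SimpleGraph.Reachable.refl b)
    simp [hD0]
  by_cases hoB : o ∈ B
  · -- `o ∈ B`: `{o ↔ B}` is everything
    have hE1 : E = univ := Set.eq_univ_of_forall fun ω => ⟨o, hoB, SimpleGraph.Reachable.refl o⟩
    simp [hE1]
  by_cases hBne : B = ∅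
  · have hE0 : E = ∅ := Set.subset_empty_iff.1 fun ω ⟨b, hb, _⟩ => by simp [hBne] at hb
    simp [hE0]
  obtain ⟨b₀, hb₀⟩ := Finset.nonempty_iff_ne_empty.2 hBne
  -- glued weights
  set w' : Sym2 (Fin n) → unitInterval := fun e => if (∀ x ∈ e, x ∈ B) then 1 else w e with hw'
  have hw'1 : ∀ e : Sym2 (Fin n), (∀ x ∈ e, x ∈ B) → (w' e : ℝ) = 1 := fun e he => by
    show ((if (∀ x ∈ e, x ∈ B) then (1 : unitInterval) else w e : unitInterval) : ℝ) = 1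
    rw [if_pos he]; rfl
  have hww' : ∀ e ∈ {e : Sym2 (Fin n) | ¬ ∀ x ∈ e, x ∈ B}, w e = w' e := fun e he => by
    simp only [mem_setOf_eq] at he
    show w e = (if (∀ x ∈ e, x ∈ B) then (1 : unitInterval) else w e)
    rw [if_neg he]
  set μ' := prodBernoulli w' with hμ'
  set G : Set (BondConfig (Fin n)) := {ω | ∀ b ∈ B, ∀ b' ∈ B, b ≠ b' → s(b, b') ∈ ω} with hG
  have hGnull : μ'.real Gᶜ = 0 := glue_null w' B hw'1
  -- the four events, as instances of the `useO/useQ` family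
  have ev : ∀ (useO useQ : Bool),
      ({ω : BondConfig (Fin n) | useO = true → ∃ b ∈ B, ω ∈ openConn o b} ∩
        (D ∩ {ω | useQ = true → ∀ p ∈ P, ω ∉ openConn p.1 p.2})) =
      (if useO then E else univ) ∩ (D ∩ (if useQ then Q else univ)) := by
    intro useO useQ
    cases useO <;> cases useQ <;> simp [hE, hD, hQ]
  have ev' : ∀ (useO useQ : Bool),
      ({ω : BondConfig (Fin n) | useO = true → ∀ v ∈ ({o} : Finset (Fin n)), ω ∈ openConn b₀ v} ∩
        ({ω | ∀ t ∈ T, ω ∉ openConn b₀ t} ∩ {ω | useQ = true → ∀ p ∈ P, ω ∉ openConn p.1 p.2})) =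
      (if useO then {ω | ∀ v ∈ ({o} : Finset (Fin n)), ω ∈ openConn b₀ v} else univ) ∩
        ({ω | ∀ t ∈ T, ω ∉ openConn b₀ t} ∩ (if useQ then Q else univ)) := by
    intro useO useQ
    cases useO <;> cases useQ <;> simp [hQ]
  -- transport of each event: μ(X_B) = μ'(X_B) = μ'(X_B ∩ G) = μ'(X_{b₀} ∩ G) = μ'(X_{b₀})
  have transport : ∀ (useO useQ : Bool),
      μ.real ((if useO then E else univ) ∩ (D ∩ (if useQ then Q else univ))) =
        μ'.real ((if useO then {ω | ∀ v ∈ ({o} : Finset (Fin n)), ω ∈ openConn b₀ v} else univ) ∩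
          ({ω | ∀ t ∈ T, ω ∉ openConn b₀ t} ∩ (if useQ then Q else univ))) := by
    intro useO useQ
    rw [← ev, ← ev']
    rw [prodBernoulli_real_eq_of_determinedBy w w' hww' (determinedBy_glue B T o P hoB hBT hP useO useQ)
      MeasurableSet.of_discrete]
    rw [real_eq_real_inter_of_null _ G hGnull, inter_clique_eq B T o b₀ hb₀ P useO useQ,
      ← real_eq_real_inter_of_null _ G hGnull]
  have t11 := transport true false
  have t01 := transport false true
  have t00 := transport false false
  have t111 := transport true true
  simp only [Bool.false_eq_true, if_true, if_false, univ_inter, inter_univ] at t11 t01 t00 t111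
  -- the vertex statement for the glued weights
  have key := terminalSeparation_general w' T {o} b₀ P hP
  rw [t11, t01, t00, t111]
  exact key

end Summit.CriticalPhenomena.PercolationContinuityZ3.Theorems
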